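import Mathlib.Algebra.Ring.BooleanRing
import Literature.Computability.QuantumComplexity.ForrelationDerivativeTables
import Literature.Computability.QuantumComplexity.ForrelationDirectSum
import Literature.Computability.AlgebraicComplexity.PowerSumNonvanishing
import Literature.NumberTheory.LFunctions.WooleyPolyToolkit

/-!
# `NearExactIsExact` (stmt-QuantumAdvantage-14043), line `direct-sum-amplification` — tools for stub F2

Helper file A for the stub `stub_mmFormCeiling` (the Maiorana–McFarland CEILING
`Φ ∈ {1} ∪ [−1, 31/32]` for cubic pairs in MM sign form, proved in the companion file
`CubicForrelationNearExactIsExactMmFormCeiling.lean`). Everything here is elementary calculus of Boolean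
functions `Q : {0,1}^m → {0,1}` in the tree's `IsDegLeFun` / `signOf` / `twist` / `bxor` vocabulary:

* Boolean bookkeeping (`fc_bool_*`), the basis vectors `Pi.single i true`, closure of degree under `⊕`, `¬`;
* `fc_const_of_shift`: a function invariant under every coordinate flip is constant;
  `fc_sum_signOf_eq_zero_of_flip`: a function negated by a flip is balanced (`Σ (-1)^Q = 0`);
  `fc_sum_signOf_eq_card`, `fc_abs_sum_signOf_le`, `fc_sum_signOf_const`: `Σ_x (-1)^{Q x}` versus `#{Q = 1}`;
* `fc_bias`: the Reed–Muller minimum weight (taken as a HYPOTHESIS, it is the neighbouring stub R) bounds the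
  bias of a non-constant cubic by `3/4 · 2^m`;
* `fc_isDegLeFun_comp`: DEGREE UNDER SUBSTITUTION — `F ∘ σ` has degree `≤ D·k` when `F` has degree `≤ k`
  and every coordinate of `σ` has degree `≤ D` (`Wooley.totalDegree_bind₁_le_mul`), with the coordinate
  degrees of the block maps `x ↦ (c ‖ x)` and `y ↦ (π y ‖ c)`; `fc_bxor_append`;
* `fc_linForm_exists`: Boolean linear forms `ℓ_y` with `(-1)^{ℓ_y(x)} = (-1)^{x·y}` (degree `≤ 1`), their
  additivity and values on basis vectors (`fc_lin_props`);
* the abstract FIBRE TRICHOTOMY (`fc_fibre_const`, `fc_fibre_balanced`, `fc_fibre_both`): given first and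
  second coordinate derivatives `R₁`, `R₂` of `Q`, vanishing of all `R₁` makes `Q` constant, vanishing of
  all `R₂` with some `R₁ ≠ 0` makes `Q` balanced, and some `R₂ ≠ 0` makes `Q` take both values.

Source of the argument: the lead's derivative-form re-derivation of Disproof §3 of the crux (see the
skeleton `work/NearExactIsExact.lean`, docstring of `stub_mmFormCeiling`); Carlet 2020 §2.2 for derivatives
and Reed–Muller weights (orientation only — no cited fact is used here).
-/

noncomputable section

set_option linter.dupNamespace false -- D-0017: single-problem summit ⇒ `QuantumAdvantage.QuantumAdvantage` by design

namespace Summit.QuantumAdvantage.QuantumAdvantage.Theorems.CubicForrelation.NearExactIsExact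

open Finset
open Literature.Computability.QuantumComplexity
open Literature.Computability.QuantumComplexity.BuzetChailloux (bxor zeroVec signOf_sq bxor_zeroVec bxorPerm
  bxorPerm_apply bxor_comm twist_zeroVec_right)
open Literature.Computability.QuantumComplexity.DerivativeWalsh (signOf_not)

variable {m n : ℕ}

/-! ### Boolean bookkeeping -/

/-- `a ⊕ b = 0 ⇒ b = a`. -/
theorem fc_bool_xor_eq_false : ∀ a b : Bool, (a ^^ b) = false → b = a := by decide

/-- `a ⊕ b = 1 ⇒ b = ¬a`. -/
theorem fc_bool_xor_eq_true : ∀ a b : Bool, (a ^^ b) = true → b = !a := by decide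

/-- An odd number of four bits are set ⇒ some bit is set and some bit is clear. -/
theorem fc_bool_odd4 : ∀ a b c d : Bool, ((a ^^ b) ^^ (c ^^ d)) = true →
    (a = true ∨ b = true ∨ c = true ∨ d = true) ∧ (a = false ∨ b = false ∨ c = false ∨ d = false) := by
  decide

/-- `(a ⊕ c) ⊕ (b ⊕ (c ⊕ d)) = (a ⊕ b) ⊕ d`. -/
theorem fc_bool_id1 : ∀ a b c d : Bool, ((a ^^ c) ^^ (b ^^ (c ^^ d))) = ((a ^^ b) ^^ d) := by decide

/-- `(a ⊕ c) ⊕ (b ⊕ c) = a ⊕ b`. -/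
theorem fc_bool_id2 : ∀ a b c : Bool, ((a ^^ c) ^^ (b ^^ c)) = (a ^^ b) := by decide

/-- Degree `≤ d` is closed under xor (sum of representing polynomials; this is
`Negative.FifteenSixteenths.IsDegLeFun.bxor'`, re-proved here to keep the imports buildable). -/
theorem fc_deg_bxor {d : ℕ} {f g : (Fin m → Bool) → Bool} (hf : IsDegLeFun d f) (hg : IsDegLeFun d g) :
    IsDegLeFun d (fun x => f x ^^ g x) := by
  have add2 : ∀ a b : ZMod 2, decide (a + b = 1) = (decide (a = 1) ^^ decide (b = 1)) := by decide
  obtain ⟨p, hp, hpf⟩ := hf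
  obtain ⟨q, hq, hqg⟩ := hg
  refine ⟨p + q, (MvPolynomial.totalDegree_add p q).trans (max_le hp hq), fun x => ?_⟩
  show (f x ^^ g x) = polyPhase (p + q) x
  rw [hpf, hqg, polyPhase_apply, polyPhase_apply, polyPhase_apply, map_add]
  exact (add2 _ _).symm

/-- Degree `≤ d` is closed under negation (add the constant `1`). -/
theorem fc_deg_bnot {d : ℕ} {f : (Fin m → Bool) → Bool} (hf : IsDegLeFun d f) :
    IsDegLeFun d (fun x => !f x) := by
  have h1 : IsDegLeFun d (fun _ : Fin m → Bool => true) := isDegLeFun_const d true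
  have e : (fun x => !f x) = fun x => (f x ^^ true) := funext fun x => by cases f x <;> rfl
  rw [e]
  exact fc_deg_bxor hf h1

/-- The basis vector `eᵢ = Pi.single i true` has coordinates `[k = i]`. -/
theorem fc_single_apply (i k : Fin m) : (Pi.single i true : Fin m → Bool) k = decide (k = i) := by
  by_cases h : k = i
  · subst h; simp
  · rw [Pi.single_eq_of_ne h, decide_eq_false h]; rfl

/-! ### Flips, constancy, balance, counting -/

/-- A Boolean function invariant under every coordinate flip `x ↦ x ⊕ eᵢ` is constant. -/
theorem fc_const_of_shift (Q : (Fin m → Bool) → Bool)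
    (h : ∀ (i : Fin m) (x : Fin m → Bool), Q (bxor x (Pi.single i true)) = Q x) (x : Fin m → Bool) :
    Q x = Q zeroVec := by
  classical
  suffices H : ∀ (s : Finset (Fin m)) (x : Fin m → Bool), (∀ i, x i = true → i ∈ s) → Q x = Q zeroVec from
    H univ x fun i _ => mem_univ i
  intro s
  induction s using Finset.induction_on with
  | empty =>
    intro x hx
    have hx0 : x = zeroVec := funext fun i => by
      cases hxi : x i with
      | false => rfl
      | true => exact absurd (hx i hxi) (Finset.notMem_empty i)
    rw [hx0]
  | @insert i s _ ih =>
    intro x hx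
    by_cases hxi : x i = true
    · rw [← h i x]
      refine ih _ fun j hj => ?_
      have hj' : (x j ^^ (Pi.single i true : Fin m → Bool) j) = true := hj
      rw [fc_single_apply] at hj'
      by_cases hji : j = i
      · subst hji; simp [hxi] at hj'
      · rw [decide_eq_false hji, Bool.xor_false] at hj'
        exact (mem_insert.1 (hx j hj')).resolve_left hji
    · refine ih x fun j hj => ?_
      have hji : j ≠ i := fun e => hxi (e ▸ hj)
      exact (mem_insert.1 (hx j hj)).resolve_left hji

/-- If the flip `x ↦ x ⊕ t` negates `Q`, the signs of `Q` sum to zero (`Q` is balanced). -/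
theorem fc_sum_signOf_eq_zero_of_flip (Q : (Fin m → Bool) → Bool) (t : Fin m → Bool)
    (h : ∀ x, Q (bxor x t) = !Q x) : ∑ x, signOf (Q x) = 0 := by
  have e1 : ∑ x, signOf (Q (bxor x t)) = ∑ x, signOf (Q x) := by
    refine Fintype.sum_equiv (bxorPerm t) _ _ fun x => ?_
    rw [bxorPerm_apply, bxor_comm]
  have e2 : ∑ x, signOf (Q (bxor x t)) = -∑ x, signOf (Q x) := by
    rw [← sum_neg_distrib]
    exact sum_congr rfl fun x _ => by rw [h, signOf_not]
  linarith

/-- `Σ_x (-1)^{Q x} = 2^m − 2·#{Q = 1}`. -/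
theorem fc_sum_signOf_eq_card (Q : (Fin m → Bool) → Bool) :
    ∑ x, signOf (Q x) = (2 : ℝ) ^ m - 2 * ((univ.filter fun x => Q x = true).card : ℝ) := by
  have e : ∀ x, signOf (Q x) = 1 - 2 * (if Q x = true then (1 : ℝ) else 0) := fun x => by
    cases Q x <;> norm_num [signOf]
  simp_rw [e]
  rw [sum_sub_distrib, ← mul_sum, sum_boole, sum_const, card_univ, Fintype.card_fun, Fintype.card_bool,
    Fintype.card_fin, nsmul_eq_mul, mul_one]
  push_cast
  ring

/-- `|Σ_x (-1)^{Q x}| ≤ 2^m`. -/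
theorem fc_abs_sum_signOf_le (Q : (Fin m → Bool) → Bool) : |∑ x, signOf (Q x)| ≤ (2 : ℝ) ^ m := by
  refine (abs_sum_le_sum_abs _ _).trans ?_
  simp only [abs_signOf, sum_const, card_univ, Fintype.card_fun, Fintype.card_bool, Fintype.card_fin,
    nsmul_eq_mul, mul_one]
  push_cast
  exact le_rfl

/-- A constant function has `Σ_x (-1)^{Q x} = 2^m · (-1)^{Q 0}`. -/
theorem fc_sum_signOf_const (Q : (Fin m → Bool) → Bool) (h : ∀ x, Q x = Q zeroVec) :
    ∑ x, signOf (Q x) = (2 : ℝ) ^ m * signOf (Q zeroVec) := by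
  rw [show ∑ x, signOf (Q x) = ∑ _x : Fin m → Bool, signOf (Q zeroVec) from
    sum_congr rfl fun x _ => by rw [h x]]
  rw [sum_const, card_univ, Fintype.card_fun, Fintype.card_bool, Fintype.card_fin, nsmul_eq_mul]
  push_cast
  ring

/-- **Bias of a non-constant cubic** (from the Reed–Muller minimum weight, hypothesis `hR` = stub R applied
with `d = 3` to `Q` and to `¬Q`): `|Σ_x (-1)^{Q x}| ≤ (3/4)·2^m`. -/
theorem fc_bias
    (hR : ∀ (m d : ℕ) (e : (Fin m → Bool) → Bool), IsDegLeFun d e → (∃ x, e x = true) →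
      2 ^ m ≤ 2 ^ d * (univ.filter fun x => e x = true).card)
    {Q : (Fin m → Bool) → Bool} (hQ : IsDegLeFun 3 Q) (h1 : ∃ x, Q x = true) (h0 : ∃ x, Q x = false) :
    |∑ x, signOf (Q x)| ≤ 3 / 4 * (2 : ℝ) ^ m := by
  obtain ⟨x0, hx0⟩ := h0
  have hT := (Nat.cast_le (α := ℝ)).2 (hR m 3 Q hQ h1)
  have hF := (Nat.cast_le (α := ℝ)).2 (hR m 3 (fun x => !Q x) (fc_deg_bnot hQ) ⟨x0, by simp [hx0]⟩)
  push_cast at hT hF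
  have hcard : ((univ.filter fun x => Q x = true).card : ℝ) +
      ((univ.filter fun x => (!Q x) = true).card : ℝ) = (2 : ℝ) ^ m := by
    have e := card_filter_add_card_filter_not (s := (univ : Finset (Fin m → Bool))) (fun x => Q x = true)
    rw [card_univ, Fintype.card_fun, Fintype.card_bool, Fintype.card_fin] at e
    have e' : (univ.filter fun x => (!Q x) = true) = univ.filter fun x => ¬(Q x = true) :=
      filter_congr fun x _ => by simp
    rw [e']
    exact_mod_cast e
  rw [fc_sum_signOf_eq_card, abs_le]
  constructor <;> nlinarith [hT, hF, hcard]

/-! ### Degree under substitution -/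

/-- Values of `𝔽₂`-polynomials at `0/1`-points are `[polyPhase]`. -/
theorem fc_eval_eq_ite (q : MvPolynomial (Fin m) (ZMod 2)) (x : Fin m → Bool) :
    MvPolynomial.eval (fun j => if x j then (1 : ZMod 2) else 0) q = if polyPhase q x then 1 else 0 := by
  have dich : ∀ a : ZMod 2, a = 0 ∨ a = 1 := by decide
  rw [polyPhase_apply]
  rcases dich (MvPolynomial.eval (fun j => if x j then (1 : ZMod 2) else 0) q) with h | h <;> rw [h] <;> decide

/-- **Degree under substitution.** If `F` has degree `≤ k` on `n` bits and every coordinate of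
`σ : {0,1}^m → {0,1}^n` has degree `≤ D`, then `F ∘ σ` has degree `≤ K` for any `K ≥ D·k`
(substitute representing polynomials: `bind₁`, `Wooley.totalDegree_bind₁_le_mul`). -/
theorem fc_isDegLeFun_comp :
    ∀ {m n k D K : ℕ} {F : (Fin n → Bool) → Bool}, IsDegLeFun k F → ∀ (σ : (Fin m → Bool) → (Fin n → Bool)),
      (∀ v, IsDegLeFun D (fun x => σ x v)) → D * k ≤ K → IsDegLeFun K (fun x => F (σ x)) := by
  intro m n k D K F hF σ hσ hK
  classical
  obtain ⟨p, hp, hpF⟩ := hF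
  choose q hq hqσ using hσ
  refine ⟨MvPolynomial.bind₁ q p, ?_, fun x => ?_⟩
  · exact (Literature.NumberTheory.LFunctions.Wooley.totalDegree_bind₁_le_mul q p hq).trans
      ((Nat.mul_le_mul_left D hp).trans hK)
  · have hpt : (fun j => if σ x j then (1 : ZMod 2) else 0) =
        fun v => MvPolynomial.eval (fun j => if x j then (1 : ZMod 2) else 0) (q v) := by
      funext v
      rw [fc_eval_eq_ite, ← hqσ v x]
    show F (σ x) = _
    rw [hpF, polyPhase_apply, polyPhase_apply,
      show MvPolynomial.eval (fun j => if x j then (1 : ZMod 2) else 0) (MvPolynomial.bind₁ q p) =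
        MvPolynomial.eval (fun v => MvPolynomial.eval (fun j => if x j then (1 : ZMod 2) else 0) (q v)) p from
        MvPolynomial.eval₂Hom_bind₁ _ _ _ _, hpt]

/-- `(a ‖ b) ⊕ (c ‖ d) = (a ⊕ c) ‖ (b ⊕ d)`. -/
theorem fc_bxor_append (a c : Fin m → Bool) (b d : Fin n → Bool) :
    bxor (Fin.append a b) (Fin.append c d) = Fin.append (bxor a c) (bxor b d) := by
  funext v
  induction v using Fin.addCases with
  | left i => simp only [bxor, Fin.append_left]
  | right j => simp only [bxor, Fin.append_right]

/-- The coordinates of `x ↦ (c ‖ x)` have degree `≤ 1`. -/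
theorem fc_deg_coord_append_left (c : Fin m → Bool) (v : Fin (m + n)) :
    IsDegLeFun 1 (fun x : Fin n → Bool => Fin.append c x v) := by
  induction v using Fin.addCases with
  | left i => simp only [Fin.append_left]; exact isDegLeFun_const 1 (c i)
  | right j => simp only [Fin.append_right]; exact isDegLeFun_apply j le_rfl

/-- The coordinates of `y ↦ (π y ‖ c)` have degree `≤ 2` when `π` is coordinatewise quadratic. -/
theorem fc_deg_coord_append_pi {π : (Fin m → Bool) → (Fin m → Bool)} (hπ : ∀ i, IsDegLeFun 2 (fun y => π y i))
    (c : Fin n → Bool) (v : Fin (m + n)) :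
    IsDegLeFun 2 (fun y : Fin m → Bool => Fin.append (π y) c v) := by
  induction v using Fin.addCases with
  | left i => simp only [Fin.append_left]; exact hπ i
  | right j => simp only [Fin.append_right]; exact isDegLeFun_const 2 (c j)

/-! ### Boolean linear forms -/

/-- `(-1)^{eᵢ·y} = (-1)^{yᵢ}`. -/
theorem fc_twist_single (i : Fin m) (y : Fin m → Bool) : twist (Pi.single i true) y = signOf (y i) := by
  rw [twist, Finset.prod_eq_single i]
  · simp [signOf]
  · intro l _ hl
    rw [fc_single_apply, decide_eq_false hl, Bool.false_and, if_neg Bool.false_ne_true]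
  · intro h; exact absurd (mem_univ i) h

/-- **Linear forms.** For every `y` there is a Boolean function `ℓ_y` of degree `≤ 1` with
`(-1)^{ℓ_y(x)} = (-1)^{x·y}` (namely `ℓ_y = Σ_{i : yᵢ = 1} Xᵢ`). -/
theorem fc_linForm_exists (m : ℕ) : ∃ l : (Fin m → Bool) → (Fin m → Bool) → Bool,
    (∀ y, IsDegLeFun 1 (l y)) ∧ ∀ y x, signOf (l y x) = twist x y := by
  refine ⟨fun y x => polyPhase (∑ i : Fin m, MvPolynomial.C (if y i then (1 : ZMod 2) else 0) * MvPolynomial.X i) x,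
    fun y => isDegLeFun_polyPhase (Literature.Computability.AlgebraicComplexity.totalDegree_sum_C_mul_X_le _),
    fun y x => ?_⟩
  have hev : MvPolynomial.eval (fun j => if x j then (1 : ZMod 2) else 0)
      (∑ i : Fin m, MvPolynomial.C (if y i then (1 : ZMod 2) else 0) * MvPolynomial.X i) =
      ((univ.filter fun i => x i && y i).card : ZMod 2) := by
    rw [map_sum, ← sum_boole]
    refine sum_congr rfl fun i _ => ?_
    rw [map_mul, MvPolynomial.eval_C, MvPolynomial.eval_X]
    cases x i <;> cases y i <;> simp
  beta_reduce
  rw [polyPhase_apply, hev, Simon.twist_eq_neg_one_pow]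
  rcases Nat.even_or_odd (univ.filter fun i => x i && y i).card with he | ho
  · rw [he.neg_one_pow, ZMod.natCast_eq_zero_iff_even.2 he, show decide ((0 : ZMod 2) = 1) = false from by decide]
    rfl
  · rw [ho.neg_one_pow, ZMod.natCast_eq_one_iff_odd.2 ho, show decide ((1 : ZMod 2) = 1) = true from by decide]
    rfl

/-- A Boolean function `l` whose sign is the character `x ↦ (-1)^{x·y}` is additive, reads `yᵢ` on the basis
vector `eᵢ` and vanishes at `0` (`signOf` is injective). -/
theorem fc_lin_props {l : (Fin m → Bool) → Bool} {y : Fin m → Bool} (hl : ∀ x, signOf (l x) = twist x y) :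
    (∀ x t, l (bxor x t) = (l x ^^ l t)) ∧ (∀ i, l (Pi.single i true) = y i) ∧ l zeroVec = false := by
  have inj : ∀ a b : Bool, signOf a = signOf b → a = b := fun a b h => by
    cases a <;> cases b <;> first | rfl | (exfalso; norm_num [signOf] at h)
  refine ⟨fun x t => inj _ _ ?_, fun i => inj _ _ ?_, inj _ _ ?_⟩
  · rw [signOf_xor, hl, hl, hl]
    exact Simon.twist_xor_left x t y
  · rw [hl, fc_twist_single]
  · rw [hl, twist_comm, twist_zeroVec_right]
    rfl

/-! ### The fibre trichotomy (abstract first/second coordinate derivatives) -/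

section Fibre

variable (Q : (Fin m → Bool) → Bool) (R₁ : Fin m → (Fin m → Bool) → Bool)
  (R₂ : Fin m → Fin m → (Fin m → Bool) → Bool)

/-- All first coordinate derivatives vanish ⇒ `Q` is constant. -/
theorem fc_fibre_const (h1 : ∀ i x, (Q x ^^ Q (bxor x (Pi.single i true))) = R₁ i x)
    (hR1 : ∀ i x, R₁ i x = false) (x : Fin m → Bool) : Q x = Q zeroVec :=
  fc_const_of_shift Q (fun i x => fc_bool_xor_eq_false _ _ ((h1 i x).trans (hR1 i x))) x

/-- All second coordinate derivatives vanish and some first derivative does not ⇒ `Q` is balanced. -/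
theorem fc_fibre_balanced (h1 : ∀ i x, (Q x ^^ Q (bxor x (Pi.single i true))) = R₁ i x)
    (h2 : ∀ i j x, (R₁ i x ^^ R₁ i (bxor x (Pi.single j true))) = R₂ i j x)
    (hR2 : ∀ i j x, R₂ i j x = false) {i : Fin m} {x₀ : Fin m → Bool} (hx₀ : R₁ i x₀ = true) :
    ∑ x, signOf (Q x) = 0 := by
  have hc : ∀ x, R₁ i x = true := by
    intro x
    have e1 := fc_const_of_shift (R₁ i) (fun j x => fc_bool_xor_eq_false _ _ ((h2 i j x).trans (hR2 i j x)))
    rw [e1 x, ← e1 x₀, hx₀]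
  exact fc_sum_signOf_eq_zero_of_flip Q (Pi.single i true) fun x => fc_bool_xor_eq_true _ _ ((h1 i x).trans (hc x))

/-- Some second coordinate derivative does not vanish ⇒ `Q` takes both values. -/
theorem fc_fibre_both (h1 : ∀ i x, (Q x ^^ Q (bxor x (Pi.single i true))) = R₁ i x)
    (h2 : ∀ i j x, (R₁ i x ^^ R₁ i (bxor x (Pi.single j true))) = R₂ i j x)
    {i j : Fin m} {x₀ : Fin m → Bool} (hx₀ : R₂ i j x₀ = true) :
    (∃ x, Q x = true) ∧ (∃ x, Q x = false) := by
  have e : ((Q x₀ ^^ Q (bxor x₀ (Pi.single i true))) ^^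
      (Q (bxor x₀ (Pi.single j true)) ^^ Q (bxor (bxor x₀ (Pi.single j true)) (Pi.single i true)))) = true := by
    rw [h1, h1, h2, hx₀]
  obtain ⟨hT, hF⟩ := fc_bool_odd4 _ _ _ _ e
  exact ⟨by rcases hT with h | h | h | h <;> exact ⟨_, h⟩, by rcases hF with h | h | h | h <;> exact ⟨_, h⟩⟩

end Fibre

end Summit.QuantumAdvantage.QuantumAdvantage.Theorems.CubicForrelation.NearExactIsExact

end
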